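import Literature.NumberTheory.Automorphic.UnitaryGroupCharpolyClassMap
import HarnessLib

/-!
# The characteristic-polynomial classes of `U(J₃)(F)` meeting the rational Borel `B(F)`
# — the index set of the hyperbolic ∕ unipotent ∕ singular terms of the fine `𝔬`-expansion
(Rogawski, *Automorphic Representations of Unitary Groups in Three Variables* (1990), §1.9 p. 9:
`M = {d(α, β, ᾱ⁻¹) : α ∈ E^*, β ∈ E¹}`, `B = MN`; §2.2–2.3 pp. 13–14: the classes `𝔬` with
`𝔬 ∩ P(F) ≠ ∅` for the proper parabolic `P = B`; §3.4–3.6 pp. 23–27: the semisimple classes of `U(3)`,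
central ∕ singular `d(α, β, α)` with centraliser `U(1,1) × U(1)` ∕ regular; Arthur, *A trace formula for
reductive groups I*, Duke Math. J. 45 (1978), §8; Arthur, *The trace formula in invariant form*, Ann. of
Math. 114 (1981), §§6–8.)

Topic `NumberTheory/Automorphic`; namespace `Literature.NumberTheory.Automorphic.UnitaryGroup`. THEOREMS
ONLY over accepted tree modules: no definition, no named fact, no `sorry`, no instance, no notation. Item
(L5-0) of the T1-qs road of `Cruxes/H413/Lines/F0_T1InnerFormTraceIdentity.lean` (cell
`pub/hodgecm-mathlib`, crux H413). With the characteristic-polynomial class map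
`cl γ = charpoly (adelicVal γ) ∈ 𝔸_E[X]` of ★ `UnitaryGroupCharpolyClassMap`, the constant term of the
fine `𝔬`-expansion splits as `J(f) = Σ_{𝔬 ∩ B(F) = ∅} (orbital integrals) + Σ_{𝔬 ∩ B(F) ≠ ∅} p_𝔬(0)` (★
`UnitaryGroupTruncatedTracePolynomialOffBorel`, ★ `UnitaryGroupArthurTraceEllipticOrbital`). This file
makes the index set of the SECOND sum explicit, for a quadratic `E/F` with involution `c` and the
quasi-split `U(J_N)`:

* §1 (all `N`) **`exists_diag_of_mem_arithmeticBorel`** — a class meeting `B(F)` is the class of a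
  rational TORUS element: `cl β = (∏ᵢ (X − C dᵢ)).map (E → 𝔸_E)` with `d : Fin N → Eˣ`,
  `c(d_{rev i}) · dᵢ = 1` (the rational Levi part of `β`, ★ `exists_unipotent_mul_torus_of_mem_borelOfForm`,
  Mathlib `Matrix.charpoly_of_upperTriangular`); conversely **`exists_mem_arithmeticBorel_of_diag`** — every
  such `d` is the diagonal of a rational torus element `diag(d) ∈ T(F) ≤ B(F)` with that class; and
  **`exists_torus_representative_of_mem_arithmeticBorel`** (a representative in `T(F)`).
* §2 (`N = 3`) **`exists_arithmeticBorel_charpoly_eq_iff`** — for `c² = 1`: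
  `(∃ β ∈ B(F), cl β = i) ↔ ∃ a ∈ Eˣ, b ∈ E¹, i = ((X − a)(X − b)(X − (c a)⁻¹)).map (E → 𝔸_E)`
  (Rogawski's `d(α, β, ᾱ⁻¹)`), i.e. the negation of the filter `∀ β : B(F), cl β ≠ i` of the two ★ sums.
* §3 (`N = 3`) the TRICHOTOMY of the classes meeting `B(F)`, intrinsic in `i`:
  (i) CENTRAL × unipotent `i = (X − z)³`, `z ∈ E¹` (`𝔬 ∋ z · 1`); (ii) SINGULAR `i = (X − a)²(X − b)`,
  `a ≠ b ∈ E¹` (semisimple part `d(a, b, a)`, centraliser `U(1,1) × U(1)`); (iii) REGULAR HYPERBOLIC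
  `i = (X − a)(X − b)(X − (c a)⁻¹)`, `a ā ≠ 1`, three pairwise distinct roots —
  **`meetsBorel_trichotomy`** (exhaustive) and the three pairwise exclusions
  **`not_central_and_singular`**, **`not_central_and_hyperbolic`**, **`not_singular_and_hyperbolic`**,
  plus **`hyperbolic_roots_pairwise_ne`**.

## References

* J. D. Rogawski, *Automorphic Representations of Unitary Groups in Three Variables*, Annals of
  Mathematics Studies 123 (1990), §1.9 (p. 9), §2.2–2.3 (pp. 13–14), §3.4–3.6 (pp. 23–27) [Rogawski1990].
* J. Arthur, *A trace formula for reductive groups I: terms associated to classes in `G(ℚ)`*, Duke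
  Math. J. 45 (1978), §8 [Arthur1978TraceFormulaI].
* J. Arthur, *The trace formula in invariant form*, Ann. of Math. 114 (1981), §§6–8
  [Arthur1981TraceFormulaInvariantForm].
-/

set_option autoImplicit false

noncomputable section

open NumberField IsDedekindDomain Matrix Polynomial
open scoped Classical MatrixGroups

namespace Literature.NumberTheory.Automorphic

namespace UnitaryGroup

variable {F E : Type} [Field F] [NumberField F] [Field E] [NumberField E] [Algebra F E]
  {c : E ≃ₐ[F] E} {N : ℕ}

/-! ## §1 A class meeting `B(F)` is the class of a rational torus element (all `N`) -/

/-- The adelic matrix of a rational element `γ₀ ∈ U(J_N)(F)` is the entrywise image of its rational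
matrix (definitional). [folklore] -/
private theorem coe_adelicVal_toAdelic (γ₀ : (quasiSplit F E c N).Rational) :
    ((adelicVal F E c N _ ((quasiSplit F E c N).toAdelic γ₀) : GL (Fin N) (AdeleRing (𝓞 E) E)) :
        Matrix (Fin N) (Fin N) (AdeleRing (𝓞 E) E)) =
      (((show ↥(rational F E c N ((StdForm.antidiagonal N).over E)) from γ₀) : GL (Fin N) E) :
        Matrix (Fin N) (Fin N) E).map (algebraMap E (AdeleRing (𝓞 E) E)) :=
  rfl

/-- A rational element lies in `B(𝔸_F)` iff its rational matrix is upper triangular (`E → 𝔸_E` is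
injective, Mathlib `AdeleRing.algebraMap_injective`). [cite: Rogawski1990, §1.9 (p. 9)] -/
theorem toAdelic_mem_borelAdelic_iff (γ₀ : (quasiSplit F E c N).Rational) :
    (quasiSplit F E c N).toAdelic γ₀ ∈ borelAdelic F E c N ↔
      ((((show ↥(rational F E c N ((StdForm.antidiagonal N).over E)) from γ₀) : GL (Fin N) E) :
        Matrix (Fin N) (Fin N) E)).BlockTriangular id := by
  rw [mem_borelAdelic_iff, coe_adelicVal_toAdelic]
  constructor
  · intro h i j hij
    have h0 := h hij
    rw [Matrix.map_apply] at h0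
    exact (map_eq_zero_iff _ (AdeleRing.algebraMap_injective (𝓞 E) E)).1 h0
  · intro h
    exact h.map (algebraMap E (AdeleRing (𝓞 E) E))

/-- **A class meeting `B(F)` is the class of a rational TORUS element** (all `N`): for `β ∈ B(F)`,
`charpoly (adelicVal β) = (∏ᵢ (X − C dᵢ)).map (E → 𝔸_E)` where `d = (β₀₀, …, β_{N-1,N-1}) ∈ (Eˣ)^N` is the
diagonal of the rational matrix of `β`, and `c(d_{rev i}) · dᵢ = 1` for every `i` (the rational Levi part
`β = u · diag(d)`, ★ `exists_unipotent_mul_torus_of_mem_borelOfForm`; `charpoly` of an upper triangular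
matrix, Mathlib `Matrix.charpoly_of_upperTriangular`). For `N = 3`: `d = (α, β, ᾱ⁻¹)`, `β ∈ E¹`.
[cite: Rogawski1990, §1.9 (p. 9); §2.2 (p. 13)] -/
theorem exists_diag_of_mem_arithmeticBorel {β : (quasiSplit F E c N).arithmeticSubgroup}
    (hβ : β ∈ arithmeticBorel F E c N) :
    ∃ d : Fin N → Eˣ, (∀ i, c (d (Fin.rev i) : E) * (d i : E) = 1) ∧
      ((adelicVal F E c N _ (β : (quasiSplit F E c N).Adelic) : GL (Fin N) (AdeleRing (𝓞 E) E)) :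
          Matrix (Fin N) (Fin N) (AdeleRing (𝓞 E) E)).charpoly =
        (∏ i : Fin N, (X - C (d i : E))).map (algebraMap E (AdeleRing (𝓞 E) E)) := by
  obtain ⟨γ₀, hγ₀⟩ := β.2
  set g : GL (Fin N) E := ((show ↥(rational F E c N ((StdForm.antidiagonal N).over E)) from γ₀) :
    GL (Fin N) E) with hg
  have hgU : g ∈ unitaryGroupOfForm (c : E →+* E) ((StdForm.antidiagonal N).over E) :=
    (show ↥(rational F E c N ((StdForm.antidiagonal N).over E)) from γ₀).2
  have hβ' : (quasiSplit F E c N).toAdelic γ₀ ∈ borelAdelic F E c N := by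
    rw [hγ₀]; exact (mem_arithmeticBorel_iff β).1 hβ
  have hgB : (g : Matrix (Fin N) (Fin N) E).BlockTriangular id := (toAdelic_mem_borelAdelic_iff γ₀).1 hβ'
  obtain ⟨u, -, d, hdT, hd, -⟩ :=
    exists_unipotent_mul_torus_of_mem_borelOfForm (σ := (c : E →+* E)) (N := N) (b := g) ⟨hgU, hgB⟩
  have hdrel : ∀ i, c (d (Fin.rev i) : E) * (d i : E) = 1 := by
    have h := (glDiagonal_mem_unitaryGroupOfForm_antidiagonal_iff (c : E →+* E) N d).1
      (torusOfForm_le_borelOfForm hdT).1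
    intro i
    have hi := h i
    rwa [RingHom.coe_coe] at hi
  refine ⟨d, hdrel, ?_⟩
  have hval : (β : (quasiSplit F E c N).Adelic) = (quasiSplit F E c N).toAdelic γ₀ := hγ₀.symm
  rw [hval, charpoly_adelicVal_toAdelic]
  change (g : Matrix (Fin N) (Fin N) E).charpoly.map _ = _
  rw [Matrix.charpoly_of_upperTriangular _ hgB]
  congr 1
  exact Finset.prod_congr rfl fun i _ => by rw [hd i]

omit [NumberField F] [NumberField E] in
/-- The rational diagonal element `diag(d)` with `c(d_{rev i}) dᵢ = 1` lies in `U(J_N)(F)`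
(★ `glDiagonal_mem_unitaryGroupOfForm_antidiagonal_iff`). [cite: Rogawski1990, §1.9 (p. 9)] -/
theorem glDiagonal_mem_rational_of_diag (d : Fin N → Eˣ) (hd : ∀ i, c (d (Fin.rev i) : E) * (d i : E) = 1) :
    glDiagonal N E d ∈ rational F E c N ((StdForm.antidiagonal N).over E) := by
  refine (glDiagonal_mem_unitaryGroupOfForm_antidiagonal_iff (c : E →+* E) N d).2 fun i => ?_
  rw [RingHom.coe_coe]
  exact hd i

/-- **Every admissible diagonal is the class of a rational torus element** (all `N`): for
`d ∈ (Eˣ)^N` with `c(d_{rev i}) dᵢ = 1`, the rational element `diag(d) ∈ T(F) ≤ B(F) ≤ G(F)` has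
`charpoly (adelicVal diag(d)) = (∏ᵢ (X − C dᵢ)).map (E → 𝔸_E)` and lies in `T(𝔸_F)`.
[cite: Rogawski1990, §1.9 (p. 9); §2.2 (p. 13)] -/
theorem exists_mem_arithmeticBorel_of_diag (d : Fin N → Eˣ)
    (hd : ∀ i, c (d (Fin.rev i) : E) * (d i : E) = 1) :
    ∃ β : (quasiSplit F E c N).arithmeticSubgroup, β ∈ arithmeticBorel F E c N ∧
      (β : (quasiSplit F E c N).Adelic) ∈ torusAdelic F E c N ∧
      ((adelicVal F E c N _ (β : (quasiSplit F E c N).Adelic) : GL (Fin N) (AdeleRing (𝓞 E) E)) :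
          Matrix (Fin N) (Fin N) (AdeleRing (𝓞 E) E)).charpoly =
        (∏ i : Fin N, (X - C (d i : E))).map (algebraMap E (AdeleRing (𝓞 E) E)) := by
  set γ₀ : (quasiSplit F E c N).Rational :=
    (show ↥(rational F E c N ((StdForm.antidiagonal N).over E)) from
      ⟨glDiagonal N E d, glDiagonal_mem_rational_of_diag d hd⟩) with hγ₀
  -- the adelic matrix of `diag(d)` is the diagonal of the principal ideles `(dᵢ)`
  have hmat : ((adelicVal F E c N _ ((quasiSplit F E c N).toAdelic γ₀) : GL (Fin N) (AdeleRing (𝓞 E) E)) :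
      Matrix (Fin N) (Fin N) (AdeleRing (𝓞 E) E)) =
      Matrix.diagonal fun i => algebraMap E (AdeleRing (𝓞 E) E) (d i : E) := by
    rw [coe_adelicVal_toAdelic]
    change ((glDiagonal N E d : GL (Fin N) E) : Matrix (Fin N) (Fin N) E).map _ = _
    rw [coe_glDiagonal, Matrix.diagonal_map (map_zero _)]
  refine ⟨⟨(quasiSplit F E c N).toAdelic γ₀, γ₀, rfl⟩, ?_, ?_, ?_⟩
  · -- upper triangular
    rw [mem_arithmeticBorel_iff]
    change (quasiSplit F E c N).toAdelic γ₀ ∈ borelAdelic F E c N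
    rw [mem_borelAdelic_iff, hmat]
    exact Matrix.blockTriangular_diagonal _
  · -- diagonal
    change (quasiSplit F E c N).toAdelic γ₀ ∈ torusAdelic F E c N
    refine ⟨fun i => Units.map (algebraMap E (AdeleRing (𝓞 E) E) : E →* AdeleRing (𝓞 E) E) (d i), ?_⟩
    refine Matrix.GeneralLinearGroup.ext fun i j => ?_
    change (glDiagonal N (AdeleRing (𝓞 E) E) _ : Matrix (Fin N) (Fin N) (AdeleRing (𝓞 E) E)) i j =
      ((adelicVal F E c N _ ((quasiSplit F E c N).toAdelic γ₀) : GL (Fin N) (AdeleRing (𝓞 E) E)) :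
        Matrix (Fin N) (Fin N) (AdeleRing (𝓞 E) E)) i j
    rw [hmat, coe_glDiagonal]
    rfl
  · -- the class
    change ((adelicVal F E c N _ ((quasiSplit F E c N).toAdelic γ₀) : GL (Fin N) (AdeleRing (𝓞 E) E)) :
        Matrix (Fin N) (Fin N) (AdeleRing (𝓞 E) E)).charpoly = _
    rw [charpoly_adelicVal_toAdelic]
    change ((glDiagonal N E d : GL (Fin N) E) : Matrix (Fin N) (Fin N) E).charpoly.map _ = _
    rw [coe_glDiagonal, Matrix.charpoly_diagonal]

/-- **Every class meeting `B(F)` has a representative in the rational torus `T(F)`** (all `N`): for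
`β ∈ B(F)` there is `t ∈ B(F)` with `t ∈ T(𝔸_F)` and `cl t = cl β` (the Levi part of `β`).
[cite: Rogawski1990, §1.9 (p. 9); §2.2 (p. 13)] -/
theorem exists_torus_representative_of_mem_arithmeticBorel {β : (quasiSplit F E c N).arithmeticSubgroup}
    (hβ : β ∈ arithmeticBorel F E c N) :
    ∃ t : (quasiSplit F E c N).arithmeticSubgroup, t ∈ arithmeticBorel F E c N ∧
      (t : (quasiSplit F E c N).Adelic) ∈ torusAdelic F E c N ∧
      ((adelicVal F E c N _ (t : (quasiSplit F E c N).Adelic) : GL (Fin N) (AdeleRing (𝓞 E) E)) :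
          Matrix (Fin N) (Fin N) (AdeleRing (𝓞 E) E)).charpoly =
        ((adelicVal F E c N _ (β : (quasiSplit F E c N).Adelic) : GL (Fin N) (AdeleRing (𝓞 E) E)) :
          Matrix (Fin N) (Fin N) (AdeleRing (𝓞 E) E)).charpoly := by
  obtain ⟨d, hd, hβd⟩ := exists_diag_of_mem_arithmeticBorel hβ
  obtain ⟨t, htB, htT, htd⟩ := exists_mem_arithmeticBorel_of_diag (F := F) (c := c) d hd
  exact ⟨t, htB, htT, by rw [htd, hβd]⟩

/-! ## §2 `N = 3`: the classes meeting `B(F)` are the `(X − α)(X − β)(X − ᾱ⁻¹)`, `β ∈ E¹` -/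

omit [NumberField F] [NumberField E] in
/-- `c (c x) = x` for an involution `c`. [folklore] -/
private theorem conj_conj (hc : c * c = 1) (x : E) : c (c x) = x := by
  rw [← AlgEquiv.mul_apply, hc, AlgEquiv.one_apply]

/-- **The classes meeting `B(F)`, `N = 3`, forward direction**: for `β ∈ B(F) ≤ U(J₃)(F)`,
`cl β = ((X − a)(X − b)(X − (c a)⁻¹)).map (E → 𝔸_E)` with `a ∈ Eˣ` and `b ∈ E¹` (`c b · b = 1`) — the
diagonal `d(α, β, ᾱ⁻¹)` of Rogawski's `M`. [cite: Rogawski1990, §1.9 (p. 9); §2.2 (p. 13)] -/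
theorem exists_charpoly_eq_of_mem_arithmeticBorel_three {β : (quasiSplit F E c 3).arithmeticSubgroup}
    (hβ : β ∈ arithmeticBorel F E c 3) :
    ∃ a b : Eˣ, c (b : E) * (b : E) = 1 ∧
      ((adelicVal F E c 3 _ (β : (quasiSplit F E c 3).Adelic) : GL (Fin 3) (AdeleRing (𝓞 E) E)) :
          Matrix (Fin 3) (Fin 3) (AdeleRing (𝓞 E) E)).charpoly =
        ((X - C (a : E)) * (X - C (b : E)) * (X - C (c (a : E))⁻¹)).map (algebraMap E (AdeleRing (𝓞 E) E)) := by
  obtain ⟨d, hd, hβd⟩ := exists_diag_of_mem_arithmeticBorel hβ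
  refine ⟨d 0, d 1, ?_, ?_⟩
  · have h1 := hd 1
    exact h1
  · rw [hβd, Fin.prod_univ_three]
    congr 2
    -- `d₂ = (c d₀)⁻¹` from `c(d₀) d₂ = 1`
    have h2 : c (d 0 : E) * (d 2 : E) = 1 := hd 2
    have hc0 : c (d 0 : E) ≠ 0 := by
      intro h0; rw [h0, zero_mul] at h2; exact zero_ne_one h2
    rw [eq_inv_of_mul_eq_one_right h2]

/-- **The classes meeting `B(F)`, `N = 3`, converse**: for `c² = 1`, every `a ∈ Eˣ`, `b ∈ E¹` gives a
rational torus element `d(a, b, (c a)⁻¹) ∈ T(F) ≤ B(F)` with `cl = ((X − a)(X − b)(X − (c a)⁻¹)).map (E → 𝔸_E)`.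
[cite: Rogawski1990, §1.9 (p. 9); §2.2 (p. 13)] -/
theorem exists_mem_arithmeticBorel_charpoly_eq_three (hc : c * c = 1) (a b : Eˣ)
    (hb : c (b : E) * (b : E) = 1) :
    ∃ β : (quasiSplit F E c 3).arithmeticSubgroup, β ∈ arithmeticBorel F E c 3 ∧
      (β : (quasiSplit F E c 3).Adelic) ∈ torusAdelic F E c 3 ∧
      ((adelicVal F E c 3 _ (β : (quasiSplit F E c 3).Adelic) : GL (Fin 3) (AdeleRing (𝓞 E) E)) :
          Matrix (Fin 3) (Fin 3) (AdeleRing (𝓞 E) E)).charpoly =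
        ((X - C (a : E)) * (X - C (b : E)) * (X - C (c (a : E))⁻¹)).map (algebraMap E (AdeleRing (𝓞 E) E)) := by
  have ha0 : c (a : E) ≠ 0 := by
    rw [map_ne_zero_iff _ c.injective]; exact a.ne_zero
  -- the third diagonal unit `(c a)⁻¹`
  set a' : Eˣ := Units.mk0 (c (a : E))⁻¹ (inv_ne_zero ha0) with ha'
  set d : Fin 3 → Eˣ := ![a, b, a'] with hdd
  have hd : ∀ i, c (d (Fin.rev i) : E) * (d i : E) = 1 := by
    intro i
    fin_cases i
    · change c (a' : E) * (a : E) = 1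
      rw [ha', Units.val_mk0, map_inv₀, conj_conj hc, inv_mul_cancel₀ a.ne_zero]
    · exact hb
    · change c (a : E) * (a' : E) = 1
      rw [ha', Units.val_mk0, mul_inv_cancel₀ ha0]
  obtain ⟨β, hβB, hβT, hβd⟩ := exists_mem_arithmeticBorel_of_diag (F := F) (c := c) d hd
  refine ⟨β, hβB, hβT, ?_⟩
  rw [hβd, Fin.prod_univ_three]
  rfl

/-- **THE CLASSES MEETING `B(F)`, BY CHARACTERISTIC POLYNOMIAL** (`N = 3`, `c² = 1`): a class
`i ∈ 𝔸_E[X]` of the characteristic-polynomial class map is the class of some `β ∈ B(F)` iff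
`i = ((X − a)(X − b)(X − (c a)⁻¹)).map (E → 𝔸_E)` for some `a ∈ Eˣ`, `b ∈ E¹` — the negation of the filter
`∀ β : B(F), cl β ≠ i` under which ★ `arthurTrace_eq_sum_offBorel_add_sum_charpoly_cm` ∕ ★
`arthurTrace_eq_sum_orbital_add_sum_charpoly_cm` split `J(f)`; these are the classes whose constant terms
`p_𝔬(0)` carry the unipotent, singular and weighted hyperbolic contributions.
[cite: Rogawski1990, §2.2–2.3 (pp. 13–14)] [cite: Arthur1978TraceFormulaI, §8] -/
theorem exists_arithmeticBorel_charpoly_eq_iff (hc : c * c = 1) (i : (AdeleRing (𝓞 E) E)[X]) :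
    (∃ β : arithmeticBorel F E c 3,
      ((adelicVal F E c 3 _ ((β : (quasiSplit F E c 3).arithmeticSubgroup) : (quasiSplit F E c 3).Adelic) :
          GL (Fin 3) (AdeleRing (𝓞 E) E)) : Matrix (Fin 3) (Fin 3) (AdeleRing (𝓞 E) E)).charpoly = i) ↔
    ∃ a b : Eˣ, c (b : E) * (b : E) = 1 ∧
      i = ((X - C (a : E)) * (X - C (b : E)) * (X - C (c (a : E))⁻¹)).map (algebraMap E (AdeleRing (𝓞 E) E)) := by
  constructor
  · rintro ⟨β, rfl⟩
    obtain ⟨a, b, hb, h⟩ := exists_charpoly_eq_of_mem_arithmeticBorel_three (F := F) (c := c) β.2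
    exact ⟨a, b, hb, h⟩
  · rintro ⟨a, b, hb, rfl⟩
    obtain ⟨β, hβB, -, hβd⟩ := exists_mem_arithmeticBorel_charpoly_eq_three (F := F) hc a b hb
    exact ⟨⟨β, hβB⟩, hβd⟩

/-- The same, phrased as the NEGATION of the `Finset.filter` predicate of the two ★ sums: `¬ (∀ β : B(F),
cl β ≠ i) ↔ ∃ a b, …`. [cite: Rogawski1990, §2.2–2.3 (pp. 13–14)] -/
theorem not_forall_arithmeticBorel_charpoly_ne_iff (hc : c * c = 1) (i : (AdeleRing (𝓞 E) E)[X]) :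
    (¬ ∀ β : arithmeticBorel F E c 3,
      ((adelicVal F E c 3 _ ((β : (quasiSplit F E c 3).arithmeticSubgroup) : (quasiSplit F E c 3).Adelic) :
          GL (Fin 3) (AdeleRing (𝓞 E) E)) : Matrix (Fin 3) (Fin 3) (AdeleRing (𝓞 E) E)).charpoly ≠ i) ↔
    ∃ a b : Eˣ, c (b : E) * (b : E) = 1 ∧
      i = ((X - C (a : E)) * (X - C (b : E)) * (X - C (c (a : E))⁻¹)).map (algebraMap E (AdeleRing (𝓞 E) E)) := by
  rw [← exists_arithmeticBorel_charpoly_eq_iff hc i]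
  simp only [ne_eq, not_forall, not_not]

/-! ## §3 `N = 3`: the trichotomy central ∕ singular ∕ regular hyperbolic -/

omit [NumberField E] in
/-- `x` is a root of `(X − a)(X − b)(X − w)` iff `x ∈ {a, b, w}` (integral domain). [folklore] -/
private theorem isRoot_three_iff {a b w x : E} :
    ((X - C a) * (X - C b) * (X - C w)).IsRoot x ↔ x = a ∨ x = b ∨ x = w := by
  simp only [Polynomial.IsRoot.def, eval_mul, eval_sub, eval_X, eval_C, mul_eq_zero, sub_eq_zero, or_assoc]

/-- The base change `E[X] → 𝔸_E[X]` is injective. [folklore] -/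
private theorem map_adele_injective :
    Function.Injective (Polynomial.map (algebraMap E (AdeleRing (𝓞 E) E))) :=
  Polynomial.map_injective _ (AdeleRing.algebraMap_injective (𝓞 E) E)

omit [NumberField F] [NumberField E] in
/-- **In the REGULAR HYPERBOLIC case the three roots are pairwise distinct**: for `c² = 1`, `a ∈ Eˣ` with
`c a · a ≠ 1` and `b ∈ E¹`, the roots `a, b, (c a)⁻¹` of `(X − a)(X − b)(X − (c a)⁻¹)` are pairwise
distinct (`d(a, b, ā⁻¹)` is a regular element of the maximal torus `M`; Rogawski §3.6).
[cite: Rogawski1990, §3.6 (p. 27)] -/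
theorem hyperbolic_roots_pairwise_ne (hc : c * c = 1) {a b : Eˣ} (ha : c (a : E) * (a : E) ≠ 1)
    (hb : c (b : E) * (b : E) = 1) :
    (a : E) ≠ (b : E) ∧ (a : E) ≠ (c (a : E))⁻¹ ∧ (b : E) ≠ (c (a : E))⁻¹ := by
  have ha0 : c (a : E) ≠ 0 := by
    rw [map_ne_zero_iff _ c.injective]; exact a.ne_zero
  refine ⟨?_, ?_, ?_⟩
  · intro h; exact ha (by rw [h]; exact hb)
  · intro h
    apply ha
    have : c (a : E) * (c (a : E))⁻¹ = 1 := mul_inv_cancel₀ ha0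
    rwa [← h] at this
  · intro h
    apply ha
    -- `b = (c a)⁻¹` gives `c b = a⁻¹` (as `c² = 1`), so `c b · b = a⁻¹ (c a)⁻¹ = 1` forces `c a · a = 1`
    have hcb : c (b : E) = (a : E)⁻¹ := by rw [h, map_inv₀, conj_conj hc]
    rw [hcb, h] at hb
    have h1 : ((a : E) * c (a : E))⁻¹ = 1 := by rwa [_root_.mul_inv_rev, mul_comm ((c (a : E))⁻¹)]
    rw [inv_eq_one] at h1
    rwa [mul_comm] at h1

omit [NumberField F] in
/-- **TRICHOTOMY OF THE CLASSES MEETING `B(F)`** (`N = 3`, `c² = 1`): a class of the shape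
`i = ((X − a)(X − b)(X − (c a)⁻¹)).map (E → 𝔸_E)`, `a ∈ Eˣ`, `b ∈ E¹`, is exactly one of
(i) CENTRAL × unipotent: `i = ((X − z)³).map`, `z ∈ E¹` — the class of the central element `z · 1`
times the unipotent variety (Arthur's `J_unip`, translated);
(ii) SINGULAR: `i = ((X − a)²(X − b)).map` with `a ≠ b` both in `E¹` — semisimple part `d(a, b, a)`,
centraliser `U(1,1) × U(1)` (Rogawski §3.5–3.6);
(iii) REGULAR HYPERBOLIC: `i = ((X − a)(X − b)(X − (c a)⁻¹)).map` with `c a · a ≠ 1` — `𝔬` a regular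
semisimple class in the split torus direction, the weighted orbital integrals (Arthur 1978 §8; Rogawski
Ch. 6). This theorem is the exhaustion; the exclusions are `not_central_and_singular`,
`not_central_and_hyperbolic`, `not_singular_and_hyperbolic`.
[cite: Rogawski1990, §3.4–3.6 (pp. 23–27)] [cite: Arthur1978TraceFormulaI, §8] -/
theorem meetsBorel_trichotomy {i : (AdeleRing (𝓞 E) E)[X]}
    (hi : ∃ a b : Eˣ, c (b : E) * (b : E) = 1 ∧
      i = ((X - C (a : E)) * (X - C (b : E)) * (X - C (c (a : E))⁻¹)).map (algebraMap E (AdeleRing (𝓞 E) E))) :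
    (∃ z : Eˣ, c (z : E) * (z : E) = 1 ∧ i = ((X - C (z : E)) ^ 3).map (algebraMap E (AdeleRing (𝓞 E) E))) ∨
    (∃ a b : Eˣ, c (a : E) * (a : E) = 1 ∧ c (b : E) * (b : E) = 1 ∧ (a : E) ≠ (b : E) ∧
      i = ((X - C (a : E)) ^ 2 * (X - C (b : E))).map (algebraMap E (AdeleRing (𝓞 E) E))) ∨
    (∃ a b : Eˣ, c (a : E) * (a : E) ≠ 1 ∧ c (b : E) * (b : E) = 1 ∧
      i = ((X - C (a : E)) * (X - C (b : E)) * (X - C (c (a : E))⁻¹)).map (algebraMap E (AdeleRing (𝓞 E) E))) := by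
  obtain ⟨a, b, hb, rfl⟩ := hi
  by_cases ha : c (a : E) * (a : E) = 1
  · -- `(c a)⁻¹ = a`
    have hinv : (c (a : E))⁻¹ = (a : E) := (eq_inv_of_mul_eq_one_right ha).symm
    by_cases hab : (a : E) = (b : E)
    · refine Or.inl ⟨a, ha, ?_⟩
      rw [hinv, ← hab]
      ring_nf
    · refine Or.inr (Or.inl ⟨a, b, ha, hb, hab, ?_⟩)
      rw [hinv]
      congr 1
      ring
  · exact Or.inr (Or.inr ⟨a, b, ha, hb, rfl⟩)

omit [NumberField F] in
/-- **Exclusion (i)∕(ii)**: a class is not both central and singular. [cite: Rogawski1990, §3.4–3.6 (pp. 23–27)] -/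
theorem not_central_and_singular {i : (AdeleRing (𝓞 E) E)[X]}
    (h₁ : ∃ z : Eˣ, c (z : E) * (z : E) = 1 ∧ i = ((X - C (z : E)) ^ 3).map (algebraMap E (AdeleRing (𝓞 E) E)))
    (h₂ : ∃ a b : Eˣ, c (a : E) * (a : E) = 1 ∧ c (b : E) * (b : E) = 1 ∧ (a : E) ≠ (b : E) ∧
      i = ((X - C (a : E)) ^ 2 * (X - C (b : E))).map (algebraMap E (AdeleRing (𝓞 E) E))) : False := by
  obtain ⟨z, -, rfl⟩ := h₁
  obtain ⟨a, b, -, -, hab, h⟩ := h₂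
  have hE : (X - C (z : E)) ^ 3 = (X - C (a : E)) ^ 2 * (X - C (b : E)) := map_adele_injective h
  have hE' : (X - C (z : E)) * (X - C (z : E)) * (X - C (z : E)) =
      (X - C (a : E)) * (X - C (a : E)) * (X - C (b : E)) := by
    rw [show (X - C (z : E)) * (X - C (z : E)) * (X - C (z : E)) = (X - C (z : E)) ^ 3 by ring, hE]; ring
  have haz : (a : E) = z := by
    have hr : ((X - C (a : E)) * (X - C (a : E)) * (X - C (b : E))).IsRoot (a : E) :=
      isRoot_three_iff.2 (Or.inl rfl)
    rw [← hE', isRoot_three_iff] at hr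
    rcases hr with h | h | h <;> exact h
  have hbz : (b : E) = z := by
    have hr : ((X - C (a : E)) * (X - C (a : E)) * (X - C (b : E))).IsRoot (b : E) :=
      isRoot_three_iff.2 (Or.inr (Or.inr rfl))
    rw [← hE', isRoot_three_iff] at hr
    rcases hr with h | h | h <;> exact h
  exact hab (haz.trans hbz.symm)

omit [NumberField F] in
/-- **Exclusion (i)∕(iii)**: a class is not both central and regular hyperbolic (`c² = 1`).
[cite: Rogawski1990, §3.4–3.6 (pp. 23–27)] -/
theorem not_central_and_hyperbolic (hc : c * c = 1) {i : (AdeleRing (𝓞 E) E)[X]}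
    (h₁ : ∃ z : Eˣ, c (z : E) * (z : E) = 1 ∧ i = ((X - C (z : E)) ^ 3).map (algebraMap E (AdeleRing (𝓞 E) E)))
    (h₃ : ∃ a b : Eˣ, c (a : E) * (a : E) ≠ 1 ∧ c (b : E) * (b : E) = 1 ∧
      i = ((X - C (a : E)) * (X - C (b : E)) * (X - C (c (a : E))⁻¹)).map (algebraMap E (AdeleRing (𝓞 E) E))) :
    False := by
  obtain ⟨z, -, rfl⟩ := h₁
  obtain ⟨a, b, ha, hb, h⟩ := h₃
  have hE : (X - C (z : E)) ^ 3 = (X - C (a : E)) * (X - C (b : E)) * (X - C (c (a : E))⁻¹) :=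
    map_adele_injective h
  have hE' : (X - C (z : E)) * (X - C (z : E)) * (X - C (z : E)) =
      (X - C (a : E)) * (X - C (b : E)) * (X - C (c (a : E))⁻¹) := by
    rw [show (X - C (z : E)) * (X - C (z : E)) * (X - C (z : E)) = (X - C (z : E)) ^ 3 by ring, hE]
  have haz : (a : E) = z := by
    have hr : ((X - C (a : E)) * (X - C (b : E)) * (X - C (c (a : E))⁻¹)).IsRoot (a : E) :=
      isRoot_three_iff.2 (Or.inl rfl)
    rw [← hE', isRoot_three_iff] at hr
    rcases hr with h | h | h <;> exact h
  have hbz : (b : E) = z := by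
    have hr : ((X - C (a : E)) * (X - C (b : E)) * (X - C (c (a : E))⁻¹)).IsRoot (b : E) :=
      isRoot_three_iff.2 (Or.inr (Or.inl rfl))
    rw [← hE', isRoot_three_iff] at hr
    rcases hr with h | h | h <;> exact h
  exact (hyperbolic_roots_pairwise_ne hc ha hb).1 (haz.trans hbz.symm)

omit [NumberField F] in
/-- **Exclusion (ii)∕(iii)**: a class is not both singular and regular hyperbolic (`c² = 1`): the
three pairwise distinct roots `a′, b′, (c a′)⁻¹` cannot all lie in the two-element set `{a, b}`.
[cite: Rogawski1990, §3.4–3.6 (pp. 23–27)] -/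
theorem not_singular_and_hyperbolic (hc : c * c = 1) {i : (AdeleRing (𝓞 E) E)[X]}
    (h₂ : ∃ a b : Eˣ, c (a : E) * (a : E) = 1 ∧ c (b : E) * (b : E) = 1 ∧ (a : E) ≠ (b : E) ∧
      i = ((X - C (a : E)) ^ 2 * (X - C (b : E))).map (algebraMap E (AdeleRing (𝓞 E) E)))
    (h₃ : ∃ a b : Eˣ, c (a : E) * (a : E) ≠ 1 ∧ c (b : E) * (b : E) = 1 ∧
      i = ((X - C (a : E)) * (X - C (b : E)) * (X - C (c (a : E))⁻¹)).map (algebraMap E (AdeleRing (𝓞 E) E))) :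
    False := by
  obtain ⟨a, b, -, -, -, rfl⟩ := h₂
  obtain ⟨a', b', ha', hb', h⟩ := h₃
  have hE : (X - C (a : E)) ^ 2 * (X - C (b : E)) =
      (X - C (a' : E)) * (X - C (b' : E)) * (X - C (c (a' : E))⁻¹) := map_adele_injective h
  have hE' : (X - C (a : E)) * (X - C (a : E)) * (X - C (b : E)) =
      (X - C (a' : E)) * (X - C (b' : E)) * (X - C (c (a' : E))⁻¹) := by
    rw [show (X - C (a : E)) * (X - C (a : E)) * (X - C (b : E)) = (X - C (a : E)) ^ 2 * (X - C (b : E)) by ring,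
      hE]
  -- every root of the right-hand side lies in `{a, b}`
  have hmem : ∀ x : E, ((X - C (a' : E)) * (X - C (b' : E)) * (X - C (c (a' : E))⁻¹)).IsRoot x →
      x = a ∨ x = b := by
    intro x hx
    rw [← hE', isRoot_three_iff] at hx
    rcases hx with h | h | h
    · exact Or.inl h
    · exact Or.inl h
    · exact Or.inr h
  have h1 := hmem (a' : E) (isRoot_three_iff.2 (Or.inl rfl))
  have h2 := hmem (b' : E) (isRoot_three_iff.2 (Or.inr (Or.inl rfl)))
  have h3 := hmem (c (a' : E))⁻¹ (isRoot_three_iff.2 (Or.inr (Or.inr rfl)))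
  obtain ⟨hab', haw', hbw'⟩ := hyperbolic_roots_pairwise_ne hc ha' hb'
  rcases h1 with h1 | h1 <;> rcases h2 with h2 | h2 <;> rcases h3 with h3 | h3
  · exact hab' (h1.trans h2.symm)
  · exact hab' (h1.trans h2.symm)
  · exact haw' (h1.trans h3.symm)
  · exact hbw' (h2.trans h3.symm)
  · exact hbw' (h2.trans h3.symm)
  · exact haw' (h1.trans h3.symm)
  · exact hab' (h1.trans h2.symm)
  · exact hab' (h1.trans h2.symm)

/-- **The central case is the class of a rational CENTRAL element**: for `z ∈ E¹` the scalar
`z · 1 ∈ Z(U(J₃))(F)` (★ `ratCenter`) lies in `B(F)` with `cl (z · 1) = ((X − z)³).map (E → 𝔸_E)`, so the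
class (i) of `meetsBorel_trichotomy` is `𝔬 ∋ z · 1` — the central elements times the unipotent variety.
[cite: Rogawski1990, §2.2 (p. 13); §3.4 (p. 23)] -/
theorem exists_mem_arithmeticBorel_charpoly_eq_pow_three (hc : c * c = 1) (z : Eˣ)
    (hz : c (z : E) * (z : E) = 1) :
    ∃ β : (quasiSplit F E c 3).arithmeticSubgroup, β ∈ arithmeticBorel F E c 3 ∧
      (β : (quasiSplit F E c 3).Adelic) ∈ torusAdelic F E c 3 ∧
      ((adelicVal F E c 3 _ (β : (quasiSplit F E c 3).Adelic) : GL (Fin 3) (AdeleRing (𝓞 E) E)) :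
          Matrix (Fin 3) (Fin 3) (AdeleRing (𝓞 E) E)).charpoly =
        ((X - C (z : E)) ^ 3).map (algebraMap E (AdeleRing (𝓞 E) E)) := by
  obtain ⟨β, hβB, hβT, hβd⟩ := exists_mem_arithmeticBorel_charpoly_eq_three (F := F) hc z z hz
  refine ⟨β, hβB, hβT, ?_⟩
  rw [hβd, (eq_inv_of_mul_eq_one_right hz).symm]
  congr 1
  ring

end UnitaryGroup

end Literature.NumberTheory.Automorphic
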